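import Mathlib
import HarnessLib
import Literature.Analysis.FluidPDE.CurlFreeLiouville

/-!
# Crux `IsobarTomography.BlobRiccatiClosure` (stmt-NavierStokesRegularity-11740), line
# `type-i-apex-liouville` — irrotational incompressible fields are harmonic on a ball

Helper file (theorems only) `--supports` the item (registered stub `stub_localHarmonic`). In
the div–curl tomography of the velocity gradient behind the apex scale floor the remainder
`h = W − K₃ ∗ curl (χ W)` is curl-free and divergence-free on a ball only; this file makes it
(vector-)harmonic there, `Δh = 0` on the ball, so that the tree's interior gradient estimate for
harmonic functions on balls applies. It is the local form of the tree's
`Literature.Analysis.FluidPDE.laplacian_eq_zero_of_curl_eq_zero_of_isDivFree`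
(`CurlFreeLiouville`): in coordinates `ΔVᵢ = Σⱼ ∂ⱼ∂ⱼVᵢ = Σⱼ ∂ⱼ∂ᵢVⱼ = ∂ᵢ div V = 0`, using
`∂ⱼVᵢ = ∂ᵢVⱼ` (vanishing curl) and the symmetry of second derivatives; the two pointwise
identities hold on an open neighbourhood of each point of the ball, so the derivatives of both
sides agree there (`Filter.EventuallyEq.fderiv_eq`). Pure calculus (Koch–Nadirashvili–Seregin–
Šverák, Acta Math. 203 (2009), Lemma 3.1, "the system `curl u = 0`, `div u = 0`").
-/

noncomputable section

open Set Filter Topology InnerProductSpace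
open scoped Laplacian RealInnerProductSpace ContDiff

-- the summit and its single sub-problem share the name (CONVENTIONS §1), as in every Theorems file
set_option linter.dupNamespace false

namespace Summit.NavierStokesRegularity.NavierStokesRegularity.Theorems.BlobRiccatiClosure.TypeIApexLiouville

open Literature.Analysis Literature.Analysis.FluidPDE

/-- Local symmetry of the Jacobian of an irrotational field: if `curl V = 0` on the ball
`B(y, ρ)` then `∂ⱼVᵢ = ∂ᵢVⱼ` there. [folklore] -/
theorem localHarmonic_fderiv_apply_comm {V : EuclideanSpace ℝ (Fin 3) → EuclideanSpace ℝ (Fin 3)}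
    {y : EuclideanSpace ℝ (Fin 3)} {ρ : ℝ} (hcurl : ∀ w ∈ Metric.ball y ρ, curl V w = 0)
    {z : EuclideanSpace ℝ (Fin 3)} (hz : z ∈ Metric.ball y ρ) (i j : Fin 3) :
    fderiv ℝ V z (EuclideanSpace.single j (1 : ℝ)) i =
      fderiv ℝ V z (EuclideanSpace.single i (1 : ℝ)) j :=
  apply_single_comm_of_curlCLM_eq_zero (by rw [← curl_eq_curlCLM]; exact hcurl z hz) i j

/-- Local symmetry of the second derivative in the value/direction indices: if `curl V = 0` on
the ball `B(y, ρ)` and `V ∈ C²`, then at every `w ∈ B(y, ρ)`,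
`(D²V(w) eₖ eⱼ)ᵢ = (D²V(w) eₖ eᵢ)ⱼ` (differentiate `∂ⱼVᵢ = ∂ᵢVⱼ`, valid on a neighbourhood of
`w`). [folklore] -/
theorem localHarmonic_fderiv_fderiv_apply_comm
    {V : EuclideanSpace ℝ (Fin 3) → EuclideanSpace ℝ (Fin 3)} (hV : ContDiff ℝ 2 V)
    {y : EuclideanSpace ℝ (Fin 3)} {ρ : ℝ} (hcurl : ∀ w ∈ Metric.ball y ρ, curl V w = 0)
    {w : EuclideanSpace ℝ (Fin 3)} (hw : w ∈ Metric.ball y ρ) (i j k : Fin 3) :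
    fderiv ℝ (fderiv ℝ V) w (EuclideanSpace.single k (1 : ℝ)) (EuclideanSpace.single j (1 : ℝ)) i =
      fderiv ℝ (fderiv ℝ V) w (EuclideanSpace.single k (1 : ℝ)) (EuclideanSpace.single i (1 : ℝ)) j := by
  rw [← fderiv_fderiv_apply_coord hV w (EuclideanSpace.single j (1 : ℝ)) (EuclideanSpace.single k (1 : ℝ)) i,
    ← fderiv_fderiv_apply_coord hV w (EuclideanSpace.single i (1 : ℝ)) (EuclideanSpace.single k (1 : ℝ)) j]
  have e : (fun z => fderiv ℝ V z (EuclideanSpace.single j (1 : ℝ)) i) =ᶠ[𝓝 w]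
      fun z => fderiv ℝ V z (EuclideanSpace.single i (1 : ℝ)) j :=
    eventuallyEq_of_mem (Metric.isOpen_ball.mem_nhds hw)
      fun z hz => localHarmonic_fderiv_apply_comm hcurl hz i j
  rw [e.fderiv_eq]

/-- The coordinate functions `z ↦ ∂ⱼVⱼ(z) = (DV(z) eⱼ)ⱼ` of a `C²` field are differentiable, with
derivative `(D²V(w) k eⱼ)ⱼ` in the direction `k`; summed over `j`:
`D(Σⱼ ∂ⱼVⱼ)(w) k = Σⱼ (D²V(w) k eⱼ)ⱼ`. [folklore] -/
theorem localHarmonic_fderiv_sum_diag {V : EuclideanSpace ℝ (Fin 3) → EuclideanSpace ℝ (Fin 3)}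
    (hV : ContDiff ℝ 2 V) (w k : EuclideanSpace ℝ (Fin 3)) :
    fderiv ℝ (fun z => ∑ j, fderiv ℝ V z (EuclideanSpace.single j (1 : ℝ)) j) w k =
      ∑ j, fderiv ℝ (fderiv ℝ V) w k (EuclideanSpace.single j (1 : ℝ)) j := by
  have hdj : ∀ j : Fin 3,
      DifferentiableAt ℝ (fun z => fderiv ℝ V z (EuclideanSpace.single j (1 : ℝ)) j) w := by
    intro j
    have hd : DifferentiableAt ℝ (fderiv ℝ V) w :=
      ((hV.fderiv_right (m := 1) le_rfl).differentiable one_ne_zero) w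
    have hdh : DifferentiableAt ℝ (fun z => fderiv ℝ V z (EuclideanSpace.single j (1 : ℝ))) w :=
      hd.clm_apply (differentiableAt_const _)
    have e1 : (fun z => fderiv ℝ V z (EuclideanSpace.single j (1 : ℝ)) j) =
        (EuclideanSpace.proj j : EuclideanSpace ℝ (Fin 3) →L[ℝ] ℝ) ∘
          fun z => fderiv ℝ V z (EuclideanSpace.single j (1 : ℝ)) := by
      funext z; rfl
    rw [e1]
    exact (EuclideanSpace.proj j : EuclideanSpace ℝ (Fin 3) →L[ℝ] ℝ).differentiableAt.comp w hdh
  rw [fderiv_fun_sum fun j _ => hdj j, _root_.sum_apply]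
  exact Finset.sum_congr rfl fun j _ => fderiv_fderiv_apply_coord hV w _ _ j

/-- Local vanishing of the derivative of the divergence: if `div V = 0` on the ball `B(y, ρ)`
and `V ∈ C²`, then `Σⱼ (D²V(w) k eⱼ)ⱼ = D(div V)(w) k = 0` at every `w ∈ B(y, ρ)`. [folklore] -/
theorem localHarmonic_sum_fderiv_fderiv_diag_eq_zero
    {V : EuclideanSpace ℝ (Fin 3) → EuclideanSpace ℝ (Fin 3)} (hV : ContDiff ℝ 2 V)
    {y : EuclideanSpace ℝ (Fin 3)} {ρ : ℝ}
    (hdiv : ∀ w ∈ Metric.ball y ρ, VectorCalculus.divergence V w = 0)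
    {w : EuclideanSpace ℝ (Fin 3)} (hw : w ∈ Metric.ball y ρ) (k : EuclideanSpace ℝ (Fin 3)) :
    ∑ j, fderiv ℝ (fderiv ℝ V) w k (EuclideanSpace.single j (1 : ℝ)) j = 0 := by
  have hzero : (fun z => ∑ j, fderiv ℝ V z (EuclideanSpace.single j (1 : ℝ)) j) =ᶠ[𝓝 w]
      fun _ => (0 : ℝ) := by
    refine eventuallyEq_of_mem (Metric.isOpen_ball.mem_nhds hw) fun z hz => ?_
    have := hdiv z hz
    rw [VectorCalculus.divergence, trace_eq_sum_coord] at this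
    exact this
  rw [← localHarmonic_fderiv_sum_diag hV w k, hzero.fderiv_eq]
  simp

/-- **An irrotational incompressible `C²` field is harmonic on a ball** (registered stub
`stub_localHarmonic`): if `V ∈ C²(ℝ³; ℝ³)` satisfies `curl V = 0` and `div V = 0` on the open
ball `B(y, ρ)`, then `ΔV = 0` on `B(y, ρ)` (coordinates:
`ΔVᵢ = Σⱼ ∂ⱼ∂ⱼVᵢ = Σⱼ ∂ⱼ∂ᵢVⱼ = Σⱼ ∂ᵢ∂ⱼVⱼ = ∂ᵢ(div V) = 0`; the local form of the tree's
`laplacian_eq_zero_of_curl_eq_zero_of_isDivFree`, the "Liouville theorem for the system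
`curl u = 0`, `div u = 0`" step of Koch–Nadirashvili–Seregin–Šverák 2009, Lemma 3.1).
[folklore] -/
theorem stub_localHarmonic : ∀ (V : EuclideanSpace ℝ (Fin 3) → EuclideanSpace ℝ (Fin 3)) (y : EuclideanSpace ℝ (Fin 3)) (ρ : ℝ), ContDiff ℝ 2 V → (∀ w ∈ Metric.ball y ρ, curl V w = 0) → (∀ w ∈ Metric.ball y ρ, VectorCalculus.divergence V w = 0) → ∀ w ∈ Metric.ball y ρ, (Δ V) w = 0 := by
  intro V y ρ hV hcurl hdiv w hw
  set T : EuclideanSpace ℝ (Fin 3) →L[ℝ] EuclideanSpace ℝ (Fin 3) →L[ℝ] EuclideanSpace ℝ (Fin 3) :=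
    fderiv ℝ (fderiv ℝ V) w with hT
  -- (1) symmetry of the second derivative in the value/direction indices (from `curl V = 0` near `w`)
  have hT1 : ∀ i j k : Fin 3, T (EuclideanSpace.single k (1 : ℝ)) (EuclideanSpace.single j (1 : ℝ)) i =
      T (EuclideanSpace.single k (1 : ℝ)) (EuclideanSpace.single i (1 : ℝ)) j := fun i j k =>
    localHarmonic_fderiv_fderiv_apply_comm hV hcurl hw i j k
  -- (2) symmetry of the second derivative in its two directions
  have hT2 : ∀ h k : EuclideanSpace ℝ (Fin 3), T h k = T k h := fun h k =>
    (hV.contDiffAt.isSymmSndFDerivAt (by simp)) h k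
  -- (3) the derivative of the divergence vanishes at `w` (from `div V = 0` near `w`)
  have hdiv' : ∀ k : EuclideanSpace ℝ (Fin 3), ∑ j, T k (EuclideanSpace.single j (1 : ℝ)) j = 0 :=
    fun k => localHarmonic_sum_fderiv_fderiv_diag_eq_zero hV hdiv hw k
  -- (4) assemble, coordinate by coordinate
  have hΔ : (Δ V) w = ∑ j, T (EuclideanSpace.single j (1 : ℝ)) (EuclideanSpace.single j (1 : ℝ)) := by
    rw [laplacian_eq_sum_fderiv_fderiv (EuclideanSpace.basisFun (Fin 3) ℝ) hV w]
    refine Finset.sum_congr rfl fun j _ => ?_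
    have hd : DifferentiableAt ℝ (fderiv ℝ V) w :=
      ((hV.fderiv_right (m := 1) le_rfl).differentiable one_ne_zero) w
    simp only [EuclideanSpace.basisFun_apply]
    rw [fderiv_clm_apply hd (differentiableAt_const _)]
    simp [hT]
  ext i
  rw [hΔ]
  simp only [PiLp.zero_apply]
  rw [show (∑ j, T (EuclideanSpace.single j (1 : ℝ)) (EuclideanSpace.single j (1 : ℝ))) i =
      ∑ j, T (EuclideanSpace.single j (1 : ℝ)) (EuclideanSpace.single j (1 : ℝ)) i from by
    simp [Finset.sum_apply]]
  calc ∑ j, T (EuclideanSpace.single j (1 : ℝ)) (EuclideanSpace.single j (1 : ℝ)) i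
        = ∑ j, T (EuclideanSpace.single j (1 : ℝ)) (EuclideanSpace.single i (1 : ℝ)) j :=
          Finset.sum_congr rfl fun j _ => hT1 i j j
    _ = ∑ j, T (EuclideanSpace.single i (1 : ℝ)) (EuclideanSpace.single j (1 : ℝ)) j :=
          Finset.sum_congr rfl fun j _ => by rw [hT2]
    _ = 0 := hdiv' (EuclideanSpace.single i (1 : ℝ))

end Summit.NavierStokesRegularity.NavierStokesRegularity.Theorems.BlobRiccatiClosure.TypeIApexLiouville

end
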